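import Summits.MatrixMultiplication.MatrixMultiplication.Theorems.FarEdgeDescentSymmetricCoverCore
import HarnessLib

/-!
# The symmetric cover: one helper copy cashes every transpose of `𝔖₂(1)^{⊠2}`
# (`⟨2⟩ ⊠ C₁^{⊠2} ≥ ⟨2,2,2⟩^{⊠2}`, the first amortisation theorem for the twisted star)

Route `FarEdgeDescent` (decomposition cell `decomp-mm`, lens 2 «structural dichotomy: special vs
generic», gen 30), support for the aside `SubLogRate` (stmt-MatrixMultiplication-25371); written for
the question left open by Kernels II/IV of this lineage (`twistedStar_pow_incomparable`,
`coupling₁_pow_incomparable`: in NO Kronecker power is `⟨n,n,2L⟩^{⊠N}` a degeneration of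
`𝔖_n(L)^{⊠N}` — so how many helper copies does the transpose cost?) and for the sister lens 4
(`Theses/OutsiderSandwich.lean`, stub «`⟨B⟩ ⊠ C₁^{⊠N} ⊵ ⟨2,2,2⟩^{⊠N}` with `B ≤ 2^{εN}`»; census
rows I54/I59 had `B(2) = 2` by an exact linear solve over `ℚ`).

The twisted star `𝔖_n(L)` is the tensor of `(X; Y, Y') ↦ (XY, XᵀY')` (`twistedStar`); lens 4's
coupled Coppersmith–Winograd block `C₁` is `𝔖₂(1)` with rotated legs (`FarEdgeDescentCouplingBridge`).
The dichotomy of this file is between the SPECIAL fibre of the `x`-slot and its GENERIC complement: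

* **Special fibre (all `n, L`).**  For any swap-invariant quotient `u` of the index set of `X`
  (`u (i,j) = u (j,i)`), substituting `x_{ij} := s_{u(i,j)}` makes BOTH leaves of `𝔖_n(L)` read the
  same symmetric-type matrix: `𝔖_n(L) ≥ symStar n L u` (`twistedStar_restrictsTo_symStar`), the
  tensor of `(S; Y, Y') ↦ (SY, SY')` — on the twist-fixed quotient the twist is invisible, in every
  Kronecker power (restriction is multiplicative).
* **Generic complement (`n = 2`, second power).**  `K^{4×4} = 𝐒 + P·𝐒`, where
  `𝐒 = Sym₂ ⊗ Sym₂` (the `9`-dimensional fixed space of both partial transposes: symmetric `4×4`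
  matrices with `M₁₄ = M₂₃`) and `P` is the permutation of the rows `(i,i') ↦ (i', i+1)` (the
  `4`-cycle `00 → 01 → 11 → 10`); the decomposition `M = S₁(M) + P·S₂(M)` has an explicit integer
  certificate (`coefOne`, `coefTwo`, checked by `decide` in `cover_identity`).  No product translate
  `(g₁ ⊗ g₂)·𝐒·(h₁ ⊗ h₂)` can replace `P` (its image in `K^{4×4}/𝐒 ≅ K⁷` has dimension `≤ 5`), so
  the covering translate is necessarily entangled across the two Kronecker factors.

Part 1 (`FarEdgeDescentSymmetricCoverCore`, same namespace) proves the special fibre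
`twistedStar_restrictsTo_symStar`, the certificate `cover_identity` and the generic cover
`ssMatMul_cover` (`(𝐒-matrix × K^{4×C}) ⊕ (𝐒-matrix × K^{4×C}) ≥ ⟨4,4,C⟩`).  This part assembles
(all sorry-free, over every commutative ring unless stated):

* `matMul444_le_two_twistedStarSq` — `⟨4,4,4⟩ ≤ (𝔖₂(1) ⊠ 𝔖₂(1)) ⊕ (𝔖₂(1) ⊠ 𝔖₂(1))`;
* `matMulSq_le_unitTwo_twistedStarSq` — `⟨2⟩ ⊠ 𝔖₂(1)^{⊠2} ≥ ⟨2,2,2⟩^{⊠2}`;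
* `matMulSq_le_unitTwo_coupling₁Sq` (over `ℂ`) — `⟨2⟩ ⊠ C₁^{⊠2} ≥ ⟨2,2,2⟩^{⊠2}`, and with Kernel II
  `exchangeRate_two`: one copy of `C₁^{⊠2}` does not even DEGENERATE to `⟨2,2,2⟩^{⊠2}`, two copies
  RESTRICT to it — the helper count at `N = 2` is exactly `2 = B(1)` (`B(1) = 2` is the sandwich
  `⟨n,n,2L⟩ ≤ 𝔖 ⊕ 𝔖` with Kernel II), i.e. the second matrix product's transposes are cashed for free
  and the exchange rate is strictly submultiplicative (`B(2) = 2 < B(1)² = 4`).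

For `n ≥ 3` two translates of `Sym_n ⊗ Sym_n` cannot cover `K^{n²×n²}` (`2·(n(n+1)/2)² < n⁴`), so the
two-copy phenomenon at `N = 2` is proved here for `n = 2` only; the general helper count is open.

## References

* D. Coppersmith, S. Winograd, *Matrix multiplication via arithmetic progressions*, J. Symb. Comp. 9
  (1990), §7 (the coupled blocks of `CW^{⊗2}`). [CoppersmithWinograd1990]
* M. Bläser, *Fast Matrix Multiplication*, Theory of Computing Graduate Surveys 5 (2013), Def. 7.2
  (restrictions by substitution), Lemma 5.5, §5 (the tensor `⟨k,m,n⟩`). [Blaser2013]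
* P. Bürgisser, M. Clausen, M. A. Shokrollahi, *Algebraic Complexity Theory* (1997), (14.28),
  (15.19)–(15.25) (restriction preorder, direct sums, Kronecker products). [BurgisserClausenShokrollahi1997]
* M. Christandl, P. Vrana, J. Zuiddam, *Universal points in the asymptotic spectrum of tensors*,
  J. AMS 36 (2023), §1.1–1.2. [ChristandlVranaZuiddam2023]
-/

noncomputable section

open scoped BigOperators

set_option linter.dupNamespace false
namespace Summit.MatrixMultiplication.MatrixMultiplication.Theorems.FarEdgeDescentSymmetricCover

open Literature.Computability.AlgebraicComplexity
  Summit.MatrixMultiplication.MatrixMultiplication.Theorems.FarEdgeDescentTwistedStar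
  Summit.MatrixMultiplication.MatrixMultiplication.Theorems.FarEdgeDescentCouplingBridge
  Summit.MatrixMultiplication.MatrixMultiplication.Theorems.OutsiderSandwichCoupling
  Summit.MatrixMultiplication.MatrixMultiplication.Theorems.OutsiderSandwichBlockNormalForm

universe u

/-! ## 3 (continued). From the twisted star to the `𝐒`-matrix product (`n = 2`, `L = 1`) -/

section Cover

variable {K : Type u} [CommRing K]

/-- Leg encoder: leaf bit `χ` (`0 = ` coherent leaf `Y`, `1 = ` twisted leaf `Y'`) and row bit
`i` give the slot index of `𝔖₂(1)`. [folklore] -/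
def leafIdx (χ i : Fin 2) : (Fin 2 × Fin 1) ⊕ (Fin 2 × Fin 1) :=
  if χ = 0 then Sum.inl (i, 0) else Sum.inr (i, 0)

/-- Leg encoder for the Kronecker square: `a = (r, ν)` with row bits `r = (i,i')` and leaf bits
`ν = (χ₁, χ₂)` (the four leaves of `𝔖₂(1)^{⊠2}` are the four columns of `Y ∈ K^{4×4}`). [folklore] -/
def enc (a : Row × Row) : ((Fin 2 × Fin 1) ⊕ (Fin 2 × Fin 1)) × ((Fin 2 × Fin 1) ⊕ (Fin 2 × Fin 1)) :=
  (leafIdx a.2.1 a.1.1, leafIdx a.2.2 a.1.2)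

/-- `symStar 2 1 wt` along the leg encoder. [folklore] -/
theorem symStar_leafIdx (χ χ' i j : Fin 2) (q : Fin 3) :
    symStar K 2 1 wt (leafIdx χ i) q (leafIdx χ' j) = if χ = χ' ∧ wt (i, j) = q then 1 else 0 := by
  fin_cases χ <;> fin_cases χ' <;> simp [leafIdx]

/-- **`𝔖₂(1) ⊠ 𝔖₂(1) ≥ 𝐒 × K^{4×4}`**: the Kronecker square of the special fibre
(`twistedStar_restrictsTo_symStar` with `u = wt`, squared) is the product of an `𝐒`-matrix with a
`4 × 4` matrix whose columns are the four leaves. [cite: BurgisserClausenShokrollahi1997, (14.28)] -/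
theorem twistedStarSq_restrictsTo_ssMatMul :
    TensorRestrictsTo (kroneckerTensor (twistedStar K 2 1) (twistedStar K 2 1)) (ssMatMul K Row) := by
  have hS : TensorRestrictsTo (twistedStar K 2 1) (symStar K 2 1 wt) :=
    twistedStar_restrictsTo_symStar 2 1 wt wt_symm
  have e : ssMatMul K Row = fun a p c =>
      kroneckerTensor (symStar K 2 1 wt) (symStar K 2 1 wt) (enc a) (id p) (enc c) := by
    funext a p c
    obtain ⟨⟨i, i'⟩, ⟨χ₁, χ₂⟩⟩ := a
    obtain ⟨⟨j, j'⟩, ⟨χ₁', χ₂'⟩⟩ := c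
    obtain ⟨p₁, p₂⟩ := p
    simp only [kroneckerTensor_apply, enc, id, symStar_leafIdx, ssMatMul, ssCoord, Prod.mk.injEq,
      ite_zero_mul_ite_zero, mul_one]
    exact ite_one_zero_congr (by tauto)
  rw [e]
  exact (hS.kronecker hS).trans (tensorRestrictsTo_precomp _ _ _ _)

/-- **`⟨4,4,4⟩ ≤ (𝔖₂(1) ⊠ 𝔖₂(1)) ⊕ (𝔖₂(1) ⊠ 𝔖₂(1))`** in bit-pair coordinates.
[cite: BurgisserClausenShokrollahi1997, (14.28)] -/
theorem rowMatMul_le_two_twistedStarSq :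
    TensorRestrictsTo (directSumTensor (kroneckerTensor (twistedStar K 2 1) (twistedStar K 2 1))
      (kroneckerTensor (twistedStar K 2 1) (twistedStar K 2 1))) (rowMatMul K Row) :=
  (twistedStarSq_restrictsTo_ssMatMul.directSum twistedStarSq_restrictsTo_ssMatMul).trans
    (ssMatMul_cover Row)

/-! ### Official formats of the target -/

/-- `⟨4,4,4⟩` in bit-pair coordinates restricts to `matMulTensor K 4 4 4` (relabelling along
`Fin 4 ≃ Fin 2 × Fin 2`). [cite: Blaser2013, Lemma 5.5] -/
theorem rowMatMul_restrictsTo_matMul444 : TensorRestrictsTo (rowMatMul K Row) (matMulTensor K 4 4 4) := by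
  -- landed-duplicate guard (lander): the folklore unfolding lemma as a local hypothesis, `rfl`
  have mm : ∀ (a b c : Fin 4 × Fin 4),
      matMulTensor K 4 4 4 a b c = if a.1 = b.1 ∧ b.2 = c.1 ∧ a.2 = c.2 then 1 else 0 :=
    fun _ _ _ => rfl
  let φ : Fin 4 → Fin 2 × Fin 2 := (finProdFinEquiv : Fin 2 × Fin 2 ≃ Fin 4).symm
  have hφ : Function.Injective φ := Equiv.injective _
  have e : matMulTensor K 4 4 4 = fun a b c =>
      rowMatMul K Row (φ a.1, φ a.2) (φ b.1, φ b.2) (φ c.1, φ c.2) := by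
    funext a b c
    simp only [mm, rowMatMul, hφ.eq_iff]
  rw [e]
  exact tensorRestrictsTo_precomp _ _ _ _

/-- `⟨4,4,4⟩` in bit-pair coordinates restricts to `⟨2,2,2⟩^{⊠2}`. [cite: ChristandlVranaZuiddam2023, §1.1] -/
theorem rowMatMul_restrictsTo_matMulPow :
    TensorRestrictsTo (rowMatMul K Row) (kroneckerPow (matMulTensor K 2 2 2) 2) := by
  -- landed-duplicate guard (lander): the folklore unfolding lemma as a local hypothesis, `rfl`
  have mm : ∀ (a b c : Fin 2 × Fin 2),
      matMulTensor K 2 2 2 a b c = if a.1 = b.1 ∧ b.2 = c.1 ∧ a.2 = c.2 then 1 else 0 :=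
    fun _ _ _ => rfl
  have e : kroneckerPow (matMulTensor K 2 2 2) 2 = fun a b c =>
      rowMatMul K Row (((a 0).1, (a 1).1), ((a 0).2, (a 1).2))
        (((b 0).1, (b 1).1), ((b 0).2, (b 1).2)) (((c 0).1, (c 1).1), ((c 0).2, (c 1).2)) := by
    funext a b c
    simp only [kroneckerPow_apply, Fin.prod_univ_two, mm, rowMatMul, Prod.mk.injEq,
      ite_zero_mul_ite_zero, mul_one]
    exact ite_one_zero_congr (by tauto)
  rw [e]
  exact tensorRestrictsTo_precomp _ _ _ _

/-- `⟨4,4,4⟩` in bit-pair coordinates restricts to `⟨2,2,2⟩ ⊠ ⟨2,2,2⟩`. [cite: ChristandlVranaZuiddam2023, §1.1] -/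
theorem rowMatMul_restrictsTo_matMul_kronecker :
    TensorRestrictsTo (rowMatMul K Row)
      (kroneckerTensor (matMulTensor K 2 2 2) (matMulTensor K 2 2 2)) := by
  -- landed-duplicate guard (lander): the folklore unfolding lemma as a local hypothesis, `rfl`
  have mm : ∀ (a b c : Fin 2 × Fin 2),
      matMulTensor K 2 2 2 a b c = if a.1 = b.1 ∧ b.2 = c.1 ∧ a.2 = c.2 then 1 else 0 :=
    fun _ _ _ => rfl
  have e : kroneckerTensor (matMulTensor K 2 2 2) (matMulTensor K 2 2 2) = fun a b c =>
      rowMatMul K Row ((a.1.1, a.2.1), (a.1.2, a.2.2)) ((b.1.1, b.2.1), (b.1.2, b.2.2))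
        ((c.1.1, c.2.1), (c.1.2, c.2.2)) := by
    funext a b c
    simp only [kroneckerTensor_apply, mm, rowMatMul, Prod.mk.injEq, ite_zero_mul_ite_zero, mul_one]
    exact ite_one_zero_congr (by tauto)
  rw [e]
  exact tensorRestrictsTo_precomp _ _ _ _

/-! ### Headline statements -/

/-- **`⟨4,4,4⟩ ≤ (𝔖₂(1) ⊠ 𝔖₂(1)) ⊕ (𝔖₂(1) ⊠ 𝔖₂(1))`** over every commutative ring: two copies of
the Kronecker square of the twisted star restrict to the full `4 × 4` matrix product — the second
copy pays for ALL FOUR partial transposes of the first. [cite: BurgisserClausenShokrollahi1997, (14.28)] -/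
theorem matMul444_le_two_twistedStarSq :
    TensorRestrictsTo (directSumTensor (kroneckerTensor (twistedStar K 2 1) (twistedStar K 2 1))
      (kroneckerTensor (twistedStar K 2 1) (twistedStar K 2 1))) (matMulTensor K 4 4 4) :=
  rowMatMul_le_two_twistedStarSq.trans rowMatMul_restrictsTo_matMul444

/-- **`⟨2⟩ ⊠ 𝔖₂(1)^{⊠2} ≥ ⟨2,2,2⟩^{⊠2}`** (helper count `2` at the second Kronecker power).
[cite: ChristandlVranaZuiddam2023, §1.1] -/
theorem matMulSq_le_unitTwo_twistedStarSq :
    TensorRestrictsTo (kroneckerTensor (unitTensor K 2) (kroneckerPow (twistedStar K 2 1) 2))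
      (kroneckerPow (matMulTensor K 2 2 2) 2) :=
  ((((TensorRestrictsTo.refl (unitTensor K 2)).kronecker
      (kroneckerPow_two_restrictsTo_kronecker (twistedStar K 2 1))).trans
      (unitTwo_kronecker_restrictsTo_directSum_self _)).trans rowMatMul_le_two_twistedStarSq).trans
    rowMatMul_restrictsTo_matMulPow

end Cover

/-! ## 4. Over `ℂ`, for lens 4's coupled block `C₁ = 𝔖₂(1)` (rotated legs) -/

section Complex

/-- `rotate ⟨n⟩ = ⟨n⟩`. [folklore] -/
private theorem rotate_unitTensor (n : ℕ) : rotate (unitTensor ℂ n) = unitTensor ℂ n := by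
  funext i j k
  simp only [rotate_apply, unitTensor_apply]
  exact if_congr (by constructor <;> rintro ⟨rfl, rfl⟩ <;> exact ⟨rfl, rfl⟩) rfl rfl

/-- **`⟨2⟩ ⊠ C₁^{⊠2} ≥ ⟨2,2,2⟩^{⊠2}` over `ℂ`**: two copies of the Kronecker square of lens 4's
coupled Coppersmith–Winograd block restrict to the Kronecker square of `⟨2,2,2⟩` (census rows
I54/I59, `B(2) = 2`, kernel-grade).  Transport of `matMulSq_le_unitTwo_twistedStarSq` along the
rotation bridge `C₁ ≥ rotate 𝔖₂(1)` and the cyclic symmetry of `⟨2,2,2⟩`.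
[cite: Blaser2013, Lemma 5.5] -/
theorem matMulSq_le_unitTwo_coupling₁Sq :
    TensorRestrictsTo (kroneckerTensor (unitTensor ℂ 2) (kroneckerPow coupling₁ 2))
      (kroneckerPow (matMulTensor ℂ 2 2 2) 2) := by
  have hB : TensorRestrictsTo
      (kroneckerTensor (rotate (unitTensor ℂ 2)) (kroneckerPow (rotate (twistedStar ℂ 2 1)) 2))
      (kroneckerPow (rotate (matMulTensor ℂ 2 2 2)) 2) :=
    (matMulSq_le_unitTwo_twistedStarSq (K := ℂ)).rotate
  have h₁ : TensorRestrictsTo (kroneckerTensor (unitTensor ℂ 2) (kroneckerPow coupling₁ 2))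
      (kroneckerTensor (rotate (unitTensor ℂ 2)) (kroneckerPow (rotate (twistedStar ℂ 2 1)) 2)) := by
    rw [rotate_unitTensor]
    exact (TensorRestrictsTo.refl _).kronecker (coupling₁_restrictsTo_rotate_twistedStar.kroneckerPow 2)
  have h₂ : TensorRestrictsTo (kroneckerPow (rotate (matMulTensor ℂ 2 2 2)) 2)
      (kroneckerPow (matMulTensor ℂ 2 2 2) 2) :=
    (tensorRestrictsTo_rotate_matMulTensor ℂ 2 2 2).kroneckerPow 2
  exact (h₁.trans hB).trans h₂

/-- The same as a degeneration (the shape of lens 4's asymptotic-restriction stub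
«`⟨B⟩ ⊠ C₁^{⊠N} ⊵ ⟨2,2,2⟩^{⊠N}`» at `N = 2` with `B = 2`). [cite: BurgisserClausenShokrollahi1997, (15.25)] -/
theorem matMulSq_degenerationOf_unitTwo_coupling₁Sq :
    AlgDegeneratesTo (kroneckerTensor (unitTensor ℂ 2) (kroneckerPow coupling₁ 2))
      (kroneckerPow (matMulTensor ℂ 2 2 2) 2) :=
  matMulSq_le_unitTwo_coupling₁Sq.algDegeneratesTo

/-- **The helper count at `N = 2` is exactly `2`.**  One copy of `C₁^{⊠2}` does not even degenerate
to `⟨2,2,2⟩^{⊠2}` (Kernel II of this lineage through the rotation bridge,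
`coupling₁_pow_not_algDegeneratesTo_matMul_pow`), while two copies restrict to it: the exchange
rate of lens 4's block against `⟨2,2,2⟩` is strictly submultiplicative (`B(2) = 2 = B(1) < B(1)²`).
[cite: Blaser2013, Thm. 6.3] -/
theorem exchangeRate_two :
    ¬ AlgDegeneratesTo (kroneckerPow coupling₁ 2) (kroneckerPow (matMulTensor ℂ 2 2 2) 2) ∧
      TensorRestrictsTo (kroneckerTensor (unitTensor ℂ 2) (kroneckerPow coupling₁ 2))
        (kroneckerPow (matMulTensor ℂ 2 2 2) 2) :=
  ⟨coupling₁_pow_not_algDegeneratesTo_matMul_pow 2 (by norm_num), matMulSq_le_unitTwo_coupling₁Sq⟩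

end Complex

end Summit.MatrixMultiplication.MatrixMultiplication.Theorems.FarEdgeDescentSymmetricCover

end
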